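import Mathlib
import Literature.Computability.AlgebraicComplexity.AlperBogartVelascoProofs
import Literature.Computability.AlgebraicComplexity.StandardFamiliesProofs
import Literature.Computability.AlgebraicComplexity.DeterminantalConormalBoundKernelAlgebra
import Summits.ValiantsHypothesis.ValiantsHypothesis.Theorems.BorderApolarityToricWitnessObstructionQPComponentCalculus

/-!
# Jet-regime theorem: preparatory lemmas

Route `ValiantsHypothesis/BorderApolarity`, crux `ToricWitnessObstructionQP`
(stmt-ValiantsHypothesis-14753), line `Sketch`, lead c5 — preparatory lemmas for the jet-regime
theorem `seven_le_of_jetRegime` (sibling file `…QPJetRegime.lean`, crux work note `regimes.md` §3):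

* `isHomogeneous_one_of_totalDegree_le_one`: affine without constant term ⟹ linear form;
* `exists_linearMap_eval`: the linear functional of a linear form;
* `det_submatrix_eq_zero_of_block`: a `3 × 3` principal minor through a `2 × 2` zero block vanishes;
* `weight_le_of_top_eq_perPoly`: if `per₃ = in_w P₃` then every variable weight is `≤ e`;
* `rankNormalForm_eq_diagonal`: Mathlib's rank normal form is a `0/1` diagonal matrix.
-/

open MvPolynomial Module Matrix Finset

-- the mandated summit-side namespace repeats a component by design (single-problem summit)
set_option linter.dupNamespace false

namespace Summit.ValiantsHypothesis.ValiantsHypothesis.Theorems.BorderApolarityToricWitnessObstructionQP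

noncomputable section

namespace JetRegime

open Literature.Computability.AlgebraicComplexity
open Literature.Computability.AlgebraicComplexity.AlperBogartVelasco LRPencil

variable {K : Type*} [Field K] {σ : Type*}

/-- An affine polynomial without constant term is a (homogeneous) linear form. [folklore] -/
theorem isHomogeneous_one_of_totalDegree_le_one [Fintype σ] {q : MvPolynomial σ K}
    (hq : q.totalDegree ≤ 1) (h0 : coeff 0 q = 0) : q.IsHomogeneous 1 := by
  have h := DeterminantalConormal.eq_C_add_sum_of_totalDegree_le_one hq
  rw [h0, C_0, zero_add] at h
  rw [h]
  exact IsHomogeneous.sum _ _ _ fun a _ => (isHomogeneous_X K a).C_mul _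

/-- The linear functional of a linear form: `x ↦ ℓ(x)`. [folklore] -/
theorem exists_linearMap_eval [Fintype σ] {ℓ : MvPolynomial σ K} (hℓ : ℓ.IsHomogeneous 1) :
    ∃ L : (σ → K) →ₗ[K] K, ∀ x, L x = eval x ℓ := by
  refine ⟨∑ a, coeff (Finsupp.single a 1) ℓ • LinearMap.proj a, fun x => ?_⟩
  have hsum : ℓ = ∑ a, coeff (Finsupp.single a 1) ℓ • X a := by
    have h := DeterminantalConormal.eq_C_add_sum_of_totalDegree_le_one (p := ℓ) hℓ.totalDegree_le
    have h0 : coeff 0 ℓ = 0 := hℓ.coeff_eq_zero (by simp)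
    rw [h0, C_0, zero_add] at h
    conv_lhs => rw [h]
    refine Finset.sum_congr rfl fun a _ => ?_
    rw [smul_eq_C_mul]
  conv_rhs => rw [hsum]
  simp [map_sum, smul_eval, eval_X]

/-- A `3 × 3` principal minor through a `2 × 2` zero block vanishes. [folklore] -/
theorem det_submatrix_eq_zero_of_block {m : ℕ} (Y : Matrix (Fin m) (Fin m) K)
    {s₁ s₂ i : Fin m} (h12 : s₁ ≠ s₂) (h1i : s₁ ≠ i) (h2i : s₂ ≠ i)
    (hz : ∀ a ∈ ({s₁, s₂} : Finset (Fin m)), ∀ b ∈ ({s₁, s₂} : Finset (Fin m)), Y a b = 0)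
    (A : Finset (Fin m)) (hA : A = {s₁, s₂, i}) :
    (Y.submatrix (fun a : A => (a : Fin m)) (fun a : A => (a : Fin m))).det = 0 := by
  classical
  subst hA
  let v : Fin 3 → Fin m := ![s₁, s₂, i]
  have hv : ∀ t, v t ∈ ({s₁, s₂, i} : Finset (Fin m)) := by
    intro t; fin_cases t <;> simp [v]
  have hinj : Function.Injective v := by
    intro a b hab
    fin_cases a <;> fin_cases b <;> simp_all [v]
  let g : Fin 3 → ↥({s₁, s₂, i} : Finset (Fin m)) := fun t => ⟨v t, hv t⟩
  have hg : Function.Bijective g := by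
    refine (Fintype.bijective_iff_injective_and_card g).2 ⟨fun a b hab => hinj ?_, ?_⟩
    · exact congr_arg Subtype.val hab
    · rw [Fintype.card_coe, Fintype.card_fin]
      rw [Finset.card_insert_of_notMem, Finset.card_insert_of_notMem, Finset.card_singleton]
      · simpa using h2i
      · simp [h12, h1i]
  let eqv : Fin 3 ≃ ↥({s₁, s₂, i} : Finset (Fin m)) := Equiv.ofBijective g hg
  rw [← Matrix.det_submatrix_equiv_self eqv]
  have h11 : Y s₁ s₁ = 0 := hz _ (by simp) _ (by simp)
  have h12' : Y s₁ s₂ = 0 := hz _ (by simp) _ (by simp)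
  have h21 : Y s₂ s₁ = 0 := hz _ (by simp) _ (by simp)
  have h22 : Y s₂ s₂ = 0 := hz _ (by simp) _ (by simp)
  rw [Matrix.det_fin_three]
  simp [eqv, g, v, h11, h12', h21, h22]

/-- Every variable occurs in `per₃` with top weight: if `per₃ = in_w P₃` then `w a ≤ e`. [folklore] -/
theorem weight_le_of_top_eq_perPoly (w : Fin 3 × Fin 3 → ℕ) (e : ℕ) (P₃ : MvPolynomial (Fin 3 × Fin 3) ℂ)
    (htop : weightedHomogeneousComponent w e P₃ = perPoly (Fin 3) ℂ) (a : Fin 3 × Fin 3) : w a ≤ e := by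
  classical
  -- `∂_a per₃ ≠ 0` (it evaluates to `per` of a `2 × 2` all-ones matrix, `= 2`)
  have hne : pderiv a (perPoly (Fin 3) ℂ) ≠ 0 := by
    intro h0
    have h := congr_arg (MvPolynomial.eval (fun _ : Fin 3 × Fin 3 => (1 : ℂ))) h0
    rw [map_zero, show a = (a.1, a.2) from rfl, eval_pderiv_perPoly_eq_permanent_submatrix] at h
    rw [Matrix.permanent_fin_two_row] at h
    simp at h
  obtain ⟨d, hd⟩ : ∃ d, coeff d (pderiv a (perPoly (Fin 3) ℂ)) ≠ 0 := by
    by_contra hall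
    push Not at hall
    exact hne (MvPolynomial.ext _ _ fun d => by rw [hall d, coeff_zero])
  rw [coeff_pderiv] at hd
  have hd' : coeff (d + Finsupp.single a 1) (perPoly (Fin 3) ℂ) ≠ 0 := fun h => hd (by rw [h, zero_mul])
  rw [← htop, coeff_weightedHomogeneousComponent] at hd'
  split_ifs at hd' with hwt
  · rw [← hwt, map_add, ComponentCalculus.weight_single_one]
    omega
  · exact absurd rfl hd'

/-- The `0/1` diagonal shape of Mathlib's rank normal form. -/
theorem rankNormalForm_eq_diagonal {m : ℕ} {r c : ℕ} (eqv : Fin m ≃ Fin r ⊕ Fin c) :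
    ((Matrix.fromBlocks 1 0 0 0 : Matrix (Fin r ⊕ Fin c) (Fin r ⊕ Fin c) K).submatrix eqv eqv) =
      Matrix.diagonal fun i => if i ∈ (Finset.univ.filter fun i => (eqv i).isRight = true) then (0 : K)
        else 1 := by
  ext i j
  rw [Matrix.submatrix_apply, Matrix.diagonal_apply]
  simp only [Finset.mem_filter, Finset.mem_univ, true_and]
  rcases hi : eqv i with a | a <;> rcases hj : eqv j with b | b
  · rw [Matrix.fromBlocks_apply₁₁, Matrix.one_apply]
    by_cases hij : i = j
    · subst hij
      rw [hi] at hj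
      cases hj
      simp
    · have hab : a ≠ b := fun h => hij (eqv.injective (by rw [hi, hj, h]))
      simp [hab, hij]
  · rw [Matrix.fromBlocks_apply₁₂, Matrix.zero_apply]
    have hij : i ≠ j := fun h => by subst h; rw [hi] at hj; cases hj
    rw [if_neg hij]
  · rw [Matrix.fromBlocks_apply₂₁, Matrix.zero_apply]
    have hij : i ≠ j := fun h => by subst h; rw [hi] at hj; cases hj
    rw [if_neg hij]
  · rw [Matrix.fromBlocks_apply₂₂, Matrix.zero_apply]
    by_cases hij : i = j
    · subst hij; simp
    · rw [if_neg hij]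

end JetRegime

/-- **Every variable of `per₃` has weight `≤ e` when `per₃ = in_w P₃`** (registered helper form
of `JetRegime.weight_le_of_top_eq_perPoly`). [folklore] -/
theorem jetRegime_weight_le_of_top : ∀ (w : Fin 3 × Fin 3 → ℕ) (e : ℕ) (P₃ : MvPolynomial (Fin 3 × Fin 3) ℂ), MvPolynomial.weightedHomogeneousComponent w e P₃ = Literature.Computability.AlgebraicComplexity.perPoly (Fin 3) ℂ → ∀ (a : Fin 3 × Fin 3), w a ≤ e :=
  fun w e P₃ htop a => JetRegime.weight_le_of_top_eq_perPoly w e P₃ htop a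

end

end Summit.ValiantsHypothesis.ValiantsHypothesis.Theorems.BorderApolarityToricWitnessObstructionQP
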